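import Summits.AnomalousDissipation.AnomalousDissipation.Theses.LoudWindows

/-!
# Glue of the CascadeLedger split of `LoudWindows.PowerFloorFamily` (stmt-AnomalousDissipation-24057)

Sorry-free proof of the GLUE item `LoudWindows.PowerFloorFamilyGlue` (stmt-AnomalousDissipation-29696):
`ScaleSaturation → SaturationCarriesFlux → FluxLedger → PowerFloorFamily` — apply K3 to K2 to get a flux plateau
`(ε, ℓ₀)`; the ledger (door) with `δ = ε/2` at `ℓ = min ℓ₀ ℓ₁` gives `4·meanPower ≥ ε/2` for `j ≥ max j₁ j₂`; re-index the
family `k ↦ k + max j₁ j₂` (`Filter.tendsto_add_atTop_iff_nat`) ⇒ a power-floor family with floor `ε/8`.  Also the converse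
`FluxLedger → PowerFloorFamily → FluxPlateau` and hence the certified translation `FluxLedger → (FluxPlateau ↔ PowerFloorFamily)`.
No facts asserted (real-number bookkeeping only).
Source: decomp-ad cell, lens-3 g6 node «CascadeLedger» (kernel `run/shared/lean/pub/decomp-ad/decomp-ad-lens-3/g6/CascadeLedger.lean`,
theorems `powerFloorFamily_of_fluxPlateau` / `fluxPlateau_of_powerFloorFamily` / `frame_iff`, tree decls Iff.rfl-identical per
`g6/post_filing_check.lean`); landed by the cell's prover seat.  Nothing here proves the summit.
-/

set_option linter.dupNamespace false

namespace Summit.AnomalousDissipation.AnomalousDissipation.Theorems.CascadeLedgerGlue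

open MeasureTheory Filter Topology Set
open Summit.AnomalousDissipation.AnomalousDissipation.Theses
open Summit.AnomalousDissipation.AnomalousDissipation.Theses.LoudWindows

/-- Door direction A ⇒ FluxPlateau: a power floor `ε` gives a flux plateau `3ε` below the ledger scale `ℓ₁(ε)`. [folklore] -/
theorem fluxPlateau_of_powerFloorFamily (hL : FluxLedger) (hA : PowerFloorFamily) : FluxPlateau := by
  obtain ⟨f, hfs, hfd, hfm, ν, u₀, u, hν, hν0, hLH, ⟨E, hE⟩, ε, hε, hεle⟩ := hA
  obtain ⟨ℓ₁, hℓ₁, hdoor⟩ := hL f ν u₀ u ⟨hfs, hfd, hfm, hν, hν0, hLH, E, hE⟩ ε hε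
  refine ⟨f, ν, u₀, u, ⟨hfs, hfd, hfm, hν, hν0, hLH, E, hE⟩, 3 * ε, by positivity, ℓ₁, hℓ₁, fun ℓ hℓ hℓle => ?_⟩
  obtain ⟨j₀, hj₀⟩ := hdoor ℓ hℓ hℓle
  refine ⟨j₀, fun j hj => ?_⟩
  have h1 := hj₀ j hj
  have h2 := hεle j
  rw [abs_le] at h1
  linarith [h1.1]

/-- Door direction FluxPlateau ⇒ A: a flux plateau `ε` gives, along a TAIL of the family (re-indexed `k ↦ k + J`),
a power floor `ε/8`. [folklore] -/
theorem powerFloorFamily_of_fluxPlateau (hL : FluxLedger) (h : FluxPlateau) : PowerFloorFamily := by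
  obtain ⟨f, ν, u₀, u, hB, ε, hε, ℓ₀, hℓ₀, hplat⟩ := h
  obtain ⟨ℓ₁, hℓ₁, hdoor⟩ := hL f ν u₀ u hB (ε / 2) (by positivity)
  obtain ⟨hfs, hfd, hfm, hν, hν0, hLH, E, hE⟩ := hB
  have hℓ : 0 < min ℓ₀ ℓ₁ := lt_min hℓ₀ hℓ₁
  obtain ⟨j₁, hj₁⟩ := hplat (min ℓ₀ ℓ₁) hℓ (min_le_left _ _)
  obtain ⟨j₂, hj₂⟩ := hdoor (min ℓ₀ ℓ₁) hℓ (min_le_right _ _)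
  refine ⟨f, hfs, hfd, hfm, fun k => ν (k + max j₁ j₂), fun k => u₀ (k + max j₁ j₂),
    fun k => u (k + max j₁ j₂), fun k => hν _, ?_, fun k => hLH _, ⟨E, fun k => hE _⟩, ε / 8, by positivity,
    fun k => ?_⟩
  · exact (Filter.tendsto_add_atTop_iff_nat (max j₁ j₂)).2 hν0
  · have hk1 : j₁ ≤ k + max j₁ j₂ := le_trans (le_max_left _ _) (Nat.le_add_left _ _)
    have hk2 : j₂ ≤ k + max j₁ j₂ := le_trans (le_max_right _ _) (Nat.le_add_left _ _)
    have h1 := hj₁ (k + max j₁ j₂) hk1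
    have h2 := hj₂ (k + max j₁ j₂) hk2
    rw [abs_le] at h2
    linarith [h2.2]

/-- The certified translation modulo the door: `FluxPlateau ↔ PowerFloorFamily`. [folklore] -/
theorem fluxPlateau_iff_powerFloorFamily (hL : FluxLedger) : FluxPlateau ↔ PowerFloorFamily :=
  ⟨powerFloorFamily_of_fluxPlateau hL, fluxPlateau_of_powerFloorFamily hL⟩

/-- GLUE item 29696 `PowerFloorFamilyGlue` by name: K2 → K3 → door → A. [folklore] -/
theorem powerFloorFamilyGlue_holds : PowerFloorFamilyGlue :=
  fun h₂ h₃ hL => (fluxPlateau_iff_powerFloorFamily hL).mp (h₃ h₂)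

end Summit.AnomalousDissipation.AnomalousDissipation.Theorems.CascadeLedgerGlue
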